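import Literature.NumberTheory.Automorphic.CongruenceSubgroupPropertySL2SymbolMulGeneral
import Literature.NumberTheory.Automorphic.CongruenceSubgroupPropertySL2AwaySymbol
import HarnessLib

/-!
# Serre's congruence subgroup property for `SL₂(ℤ[1/m])` — proofs, A-V: Liehl's (11) (general case),
# (12)–(14) and (7) = MS2 over `A = ℤ[1/m]`

Topic `Literature/NumberTheory/Automorphic`; namespace `Literature.NumberTheory.Automorphic.SL2Rel.Away`.
Everything here is PROVED; no definitions, no named facts.

This file ports the `section NumberField` parts of files XVII–XIX of the tree's `𝓞_F` story
(`CongruenceSubgroupPropertySL2SymbolMulGeneral.lean`, `…Multiplicative.lean`, `…MennickeOfSL2.lean`)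
to `A = ℤ[1/m]`, `m ≥ 2`:

* **Liehl (11)**, general case (`SL2Rel.Away.sym_mul_sym`): Liehl's prime `a' = a + b₁b₂y` with residue
  field `≠ 𝔽₂, 𝔽₃` is here a RATIONAL prime `p ≡ a (mod (a - 1)b₁b₂)`, `p > max(m, 4)`, from Dirichlet's
  theorem in `ℤ[1/m]` (`SerreSL2.Away.exists_prime_natCast_sub_mem`, file A-I), with
  `ℤ[1/m]/(p) ≅ 𝔽_p`; the conic over `𝔽_p` is the tree's `exists_conic_sol` (Cauchy–Davenport);
* **(12)**, **(13)** (`sym_mul_eq_of_mem_sq`, `sym_mul_eq`; conjugation by `diag(y, 1)` inside `SL₂`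
  of the field of fractions), **(14)** (`sym_mul_left`), `mk_eq_mk_iff` (classes modulo `E(𝔮, A)`,
  which is normal by (5), file A-III);
* **(7) = MS2** (`sym_mul_right`): `[b₁b₂ over a] = [b₁ over a][b₂ over a]` on `W(𝔮, A)`.

So the first-row symbol `W(𝔮, A) → G(𝔮, A) ⧸ ncl E(𝔮, A)` of file XIV is a Mennicke symbol for
`A = ℤ[1/m]` (Vaserstein's Lemma 3); it is packaged and shown trivial in the next files.

## References

* [Liehl1981SL2Orders] B. Liehl, J. reine angew. Math. 323 (1981) 153–171, §3 (3), (7), (11)–(15).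
* [Vaserstein1972SL2] L. N. Vaserstein, Mat. Sb. 89 (131) (1972) 313–322, Lemma 3.
* [BassMilnorSerre1967] H. Bass, J. Milnor, J.-P. Serre, Publ. Math. IHES 33 (1967), Appendix (A.10).
-/

open Matrix MatrixGroups

namespace Literature.NumberTheory.Automorphic

namespace SL2Rel

namespace Away

section Liehl

variable {m : ℕ} {F : Type*} [Field F] [Algebra (Localization.Away (m : ℤ)) F]
  [IsFractionRing (Localization.Away (m : ℤ)) F]
variable (hm : 2 ≤ m)
include hm

/-! ### Liehl's (11), general case, over `ℤ[1/m]` -/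

omit hm in
/-- `[b over u] = 1` for a unit `u ≡ 1 (mod z⁴)`, `z ∈ 𝔮`, `b ∈ 𝔮`: `[b over u] = [0 over u]` by (6) and
`diag(u, u⁻¹) ∈ E(𝔮, A)` (`u = 1 + xy`, `x, y ∈ 𝔮`). [cite: Liehl1981SL2Orders, §3 (11)] -/
theorem sym_eq_one_of_isUnit {𝔮 : Ideal (Localization.Away (m : ℤ))} {z : Localization.Away (m : ℤ)} (hz : z ∈ 𝔮) {a b : Localization.Away (m : ℤ)}
    (ha : a - 1 ∈ Ideal.span {z * z * (z * z)}) (hu : IsUnit a) (hb : b ∈ 𝔮) : sym 𝔮 a b = 1 := by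
  obtain ⟨u, rfl⟩ := hu
  have hzz : z * z ∈ 𝔮 := 𝔮.mul_mem_left _ hz
  obtain ⟨s, hs⟩ := Ideal.mem_span_singleton'.1 ha
  have ha𝔮 : (u : Localization.Away (m : ℤ)) - 1 ∈ 𝔮 := by rw [← hs]; exact 𝔮.mul_mem_left _ (𝔮.mul_mem_left _ hzz)
  have hub : IsCoprime (u : Localization.Away (m : ℤ)) b := ⟨↑u⁻¹, 0, by simp⟩
  -- `[b over u] = [0 over u]`
  have h1 : sym 𝔮 (u : Localization.Away (m : ℤ)) b = sym 𝔮 u 0 := by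
    have h := sym_add_mul_right ha𝔮 hb hub (𝔮.neg_mem (𝔮.mul_mem_right (↑u⁻¹ : Localization.Away (m : ℤ)) hb))
    rw [show b + -(b * ↑u⁻¹) * (u : Localization.Away (m : ℤ)) = 0 by
      linear_combination (-b) * u.inv_mul] at h
    exact h.symm
  -- `diag(u, u⁻¹) ∈ E(𝔮, A)` with first row `(u, 0)`
  have hu' : (u : Localization.Away (m : ℤ)) = 1 + z * z * (s * (z * z)) := by linear_combination -hs
  obtain ⟨k00, k01, -, -⟩ := diag_four_apply (z * z) (s * (z * z)) u hu'
  have hE : e12 (z * z) * e21 (s * (z * z)) * e12 (-(z * z * ↑u⁻¹)) * e21 (-(s * (z * z) * u)) ∈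
      relE 𝔮 ⊤ :=
    mul_mem (mul_mem (mul_mem (e12_mem_relE hzz) (e21_mem_relE Submodule.mem_top))
      (e12_mem_relE (𝔮.neg_mem (𝔮.mul_mem_right _ hzz)))) (e21_mem_relE Submodule.mem_top)
  rw [h1, sym_eq_mk ⟨_, relE_le_relG _ _ hE⟩ k00 k01]
  exact mk_eq_one_of_mem_relE _ hE

omit hm in
/-- `[b over a] = 1` if `b` is a unit (`(a, b) ∼ (1, b)` by (6)). [cite: Liehl1981SL2Orders, §3 (6)] -/
theorem sym_eq_one_of_isUnit_right {𝔮 : Ideal (Localization.Away (m : ℤ))} {a b : Localization.Away (m : ℤ)} (ha : a - 1 ∈ 𝔮) (hb : b ∈ 𝔮)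
    (hu : IsUnit b) : sym 𝔮 a b = 1 := by
  obtain ⟨u, rfl⟩ := hu
  have hau : IsCoprime a (u : Localization.Away (m : ℤ)) := ⟨0, ↑u⁻¹, by simp⟩
  have h := sym_add_mul_left ha hb hau ((1 - a) * ↑u⁻¹)
  rw [show a + (1 - a) * ↑u⁻¹ * (u : Localization.Away (m : ℤ)) = 1 by rw [mul_assoc, Units.inv_mul]; ring,
    sym_one_left hb] at h
  exact h.symm

/-- **Case 3 of (11) from a solution of the conic modulo a prime `a`**: if `(a) = P` is a maximal ideal
with residue field of prime order `p ≥ 5`, `(a, b₁)`, `(a, b₂)` rows of `G(z²A, z²A)`, then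
`[b₁ over a][b₂ over a] = [b₁b₂ over a]`. [cite: Liehl1981SL2Orders, §3 (11) (Case 3, general case)] -/
theorem sym_mul_sym_of_prime {𝔮 : Ideal (Localization.Away (m : ℤ))} {z : Localization.Away (m : ℤ)} (hz : z ∈ 𝔮) (hz0 : z ≠ 0)
    {a b₁ b₂ : Localization.Away (m : ℤ)} (ha : a - 1 ∈ Ideal.span {z * z * (z * z)}) (hb₁ : b₁ ∈ Ideal.span {z * z})
    (hb₂ : b₂ ∈ Ideal.span {z * z}) (hab₁ : IsCoprime a b₁) (hab₂ : IsCoprime a b₂)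
    [(Ideal.span {a}).IsMaximal] {p : ℕ} (hp : p.Prime) (h5 : 5 ≤ p)
    [Fintype (Localization.Away (m : ℤ) ⧸ Ideal.span {a})] (hcard : Fintype.card (Localization.Away (m : ℤ) ⧸ Ideal.span {a}) = p) :
    sym 𝔮 a b₁ * sym 𝔮 a b₂ = sym 𝔮 a (b₁ * b₂) := by
  classical
  haveI : Fact p.Prime := ⟨hp⟩
  set e : ZMod p ≃+* Localization.Away (m : ℤ) ⧸ Ideal.span {a} := ZMod.ringEquivOfPrime (Localization.Away (m : ℤ) ⧸ Ideal.span {a}) hp hcard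
    with he
  have hPtop : Ideal.span {a} ≠ ⊤ := Ideal.IsMaximal.ne_top inferInstance
  have hau : ¬ IsUnit a := fun h ↦ hPtop (by rwa [Ideal.span_singleton_eq_top])
  -- `b ≢ 0 (mod a)` for `(a, b) = 1`, and conversely `(a, x) = 1` for `x ≢ 0`
  have hne : ∀ {b : Localization.Away (m : ℤ)}, IsCoprime a b → Ideal.Quotient.mk (Ideal.span {a}) b ≠ 0 := by
    intro b hab h
    rw [Ideal.Quotient.eq_zero_iff_mem, Ideal.mem_span_singleton] at h
    exact hau (hab.isUnit_of_dvd' dvd_rfl h)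
  have hcop : ∀ {x : Localization.Away (m : ℤ)}, Ideal.Quotient.mk (Ideal.span {a}) x ≠ 0 → IsCoprime a x := by
    intro x hx
    have hxP : x ∉ Ideal.span {a} := fun h ↦ hx (by rwa [Ideal.Quotient.eq_zero_iff_mem])
    obtain ⟨y, i, hi, hyi⟩ := Ideal.IsMaximal.exists_inv inferInstance hxP
    rw [Ideal.mem_span_singleton'] at hi
    obtain ⟨c, rfl⟩ := hi
    exact ⟨c, y, by linear_combination hyi⟩
  -- the conic over `𝔽_p`
  set b₁' : ZMod p := e.symm (Ideal.Quotient.mk (Ideal.span {a}) b₁) with hb₁'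
  set b₂' : ZMod p := e.symm (Ideal.Quotient.mk (Ideal.span {a}) b₂) with hb₂'
  have hb₁'e : e b₁' = Ideal.Quotient.mk (Ideal.span {a}) b₁ := e.apply_symm_apply _
  have hb₂'e : e b₂' = Ideal.Quotient.mk (Ideal.span {a}) b₂ := e.apply_symm_apply _
  have hb₁'0 : b₁' ≠ 0 := fun h ↦ hne hab₁ (by rw [← hb₁'e, h, map_zero])
  have hb₂'0 : b₂' ≠ 0 := fun h ↦ hne hab₂ (by rw [← hb₂'e, h, map_zero])
  obtain ⟨u', v', w', hu', hv', hconic⟩ := exists_conic_sol hp h5 hb₁'0 hb₂'0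
  set x' : ZMod p := u' * (b₂' * v')⁻¹ with hx'
  set y' : ZMod p := w' * u'⁻¹ with hy'
  have E1 : x' * (b₂' * v') = u' := by rw [hx', inv_mul_cancel_right₀ (mul_ne_zero hb₂'0 hv')]
  have E2 : y' * u' = w' := by rw [hy', inv_mul_cancel_right₀ hu']
  have hx'0 : x' ≠ 0 := by
    rw [hx']; exact mul_ne_zero hu' (inv_ne_zero (mul_ne_zero hb₂'0 hv'))
  have key : b₁' * b₂' * x' ^ 2 - y' ^ 2 * x' ^ 2 * b₂' + 1 = 0 := by
    have h : (b₁' * b₂' * x' ^ 2 - y' ^ 2 * x' ^ 2 * b₂' + 1) * (b₂' * v' ^ 2) = 0 := by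
      linear_combination ((b₁' - y' ^ 2) * (b₂' * x' * v' + u')) * E1 + hconic -
        (y' * u' + w') * E2
    rcases mul_eq_zero.1 h with h | h
    · exact h
    · exact absurd h (mul_ne_zero hb₂'0 (pow_ne_zero 2 hv'))
  -- lift `x', y'` to `x₁, y₁ ∈ A`, then move them into `zA` without changing them mod `a`
  obtain ⟨x₁, hx₁⟩ := Ideal.Quotient.mk_surjective (I := Ideal.span {a}) (e x')
  obtain ⟨y₁, hy₁⟩ := Ideal.Quotient.mk_surjective (I := Ideal.span {a}) (e y')
  have haz : IsCoprime a z := by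
    obtain ⟨s, hs⟩ := Ideal.mem_span_singleton'.1 ha
    exact ⟨1, -(s * z * (z * z)), by linear_combination -hs⟩
  obtain ⟨p', q', hpq⟩ := haz
  set x₀ := x₁ * (q' * z) with hx₀
  set y₀ := y₁ * (q' * z) with hy₀
  have hqz : Ideal.Quotient.mk (Ideal.span {a}) (q' * z) = 1 := by
    rw [show q' * z = 1 - p' * a by linear_combination hpq, map_sub, map_one, sub_eq_self,
      Ideal.Quotient.eq_zero_iff_mem]
    exact Ideal.mul_mem_left _ _ (Ideal.mem_span_singleton_self a)
  have hmx₀ : Ideal.Quotient.mk (Ideal.span {a}) x₀ = e x' := by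
    rw [hx₀, map_mul, hqz, hx₁]; exact mul_one (e x')
  have hmy₀ : Ideal.Quotient.mk (Ideal.span {a}) y₀ = e y' := by
    rw [hy₀, map_mul, hqz, hy₁]; exact mul_one (e y')
  have hrel : b₁ * b₂ * x₀ * x₀ - y₀ * y₀ * x₀ * x₀ * b₂ + 1 ∈ Ideal.span {a} := by
    rw [← Ideal.Quotient.eq_zero_iff_mem]
    have : Ideal.Quotient.mk (Ideal.span {a}) (b₁ * b₂ * x₀ * x₀ - y₀ * y₀ * x₀ * x₀ * b₂ + 1) =
        e (b₁' * b₂' * x' ^ 2 - y' ^ 2 * x' ^ 2 * b₂' + 1) := by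
      simp only [map_add, map_sub, map_mul, map_pow, map_one, hmx₀, hmy₀, hb₁'e, hb₂'e]
      ring
    rw [this, key, map_zero]
  have hax₀ : IsCoprime a x₀ := by
    refine (hcop fun h ↦ hx'0 ?_).mul_right ⟨p', 1, by linear_combination hpq⟩
    exact e.injective (by rw [map_zero, ← hx₁]; exact h)
  refine sym_case3 hm hz hz0 ha hb₁ hb₂ hab₁ hab₂ ?_ ?_ hrel hax₀
  · exact Ideal.mem_span_singleton'.2 ⟨x₁ * q', by rw [hx₀]; ring⟩
  · exact Ideal.mem_span_singleton'.2 ⟨y₁ * q', by rw [hy₀]; ring⟩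

/-- **Liehl (11)** for the pair `(𝔮, A)`, `A = ℤ[1/m]`: for `0 ≠ z ∈ 𝔮` and `(a, b₁)`, `(a, b₂)` first rows
of matrices in `G(z²A, z²A)` (i.e. `a - 1 ∈ z⁴A`, `bᵢ ∈ z²A`, `(a, bᵢ) = 1`):
`[b₁ over a][b₂ over a] = [b₁b₂ over a]`. [cite: Liehl1981SL2Orders, §3 (11)] -/
theorem sym_mul_sym {𝔮 : Ideal (Localization.Away (m : ℤ))} {z : Localization.Away (m : ℤ)} (hz : z ∈ 𝔮) (hz0 : z ≠ 0) {a b₁ b₂ : Localization.Away (m : ℤ)}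
    (ha : a - 1 ∈ Ideal.span {z * z * (z * z)}) (hb₁ : b₁ ∈ Ideal.span {z * z})
    (hb₂ : b₂ ∈ Ideal.span {z * z}) (hab₁ : IsCoprime a b₁) (hab₂ : IsCoprime a b₂) :
    sym 𝔮 a b₁ * sym 𝔮 a b₂ = sym 𝔮 a (b₁ * b₂) := by
  haveI := SL2Rel.isDomain_away (show m ≠ 0 by omega)
  classical
  have hzz : z * z ∈ 𝔮 := 𝔮.mul_mem_left _ hz
  have hI𝔮 : Ideal.span {z * z} ≤ 𝔮 := (Ideal.span_singleton_le_iff_mem _).2 hzz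
  have hz4 : Ideal.span {z * z * (z * z)} ≤ 𝔮 :=
    (Ideal.span_singleton_le_iff_mem _).2 (𝔮.mul_mem_left _ hzz)
  have ha𝔮 : a - 1 ∈ 𝔮 := hz4 ha
  -- `a` a unit (covers `a = 1` and `b₁b₂ = 0`)
  by_cases hau : IsUnit a
  · rw [sym_eq_one_of_isUnit hz ha hau (hI𝔮 hb₁), sym_eq_one_of_isUnit hz ha hau (hI𝔮 hb₂),
      sym_eq_one_of_isUnit hz ha hau (𝔮.mul_mem_left _ (hI𝔮 hb₂)), one_mul]
  have hb0 : b₁ * b₂ ≠ 0 := by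
    refine mul_ne_zero (fun h ↦ hau ?_) (fun h ↦ hau ?_)
    · rw [h, isCoprime_zero_right] at hab₁; exact hab₁
    · rw [h, isCoprime_zero_right] at hab₂; exact hab₂
  -- `a = 0`: `b₁, b₂` are units
  by_cases ha0 : a = 0
  · rw [ha0] at hab₁ hab₂ ha𝔮 ⊢
    rw [isCoprime_zero_left] at hab₁ hab₂
    rw [sym_eq_one_of_isUnit_right ha𝔮 (hI𝔮 hb₁) hab₁,
      sym_eq_one_of_isUnit_right ha𝔮 (hI𝔮 hb₂) hab₂,
      sym_eq_one_of_isUnit_right ha𝔮 (𝔮.mul_mem_left _ (hI𝔮 hb₂)) (hab₁.mul hab₂), one_mul]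
  have ha1 : a - 1 ≠ 0 := fun h ↦ hau (by rw [sub_eq_zero.1 h]; exact isUnit_one)
  -- Dirichlet in `ℤ[1/m]`: a rational prime `p ≡ a (mod (a - 1)b₁b₂)`, `p > max m 4`
  have hm0 : m ≠ 0 := by omega
  have h𝔪0 : Ideal.span {(a - 1) * (b₁ * b₂)} ≠ ⊥ := by
    rw [Ne, Ideal.span_singleton_eq_bot]; exact mul_ne_zero ha1 hb0
  obtain ⟨M, hM, hMc, hspan⟩ := SerreSL2.Away.exists_coprime_eq_span hm0 h𝔪0
  have haM : IsCoprime a ((M : ℕ) : Localization.Away (m : ℤ)) :=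
    SerreSL2.Away.isCoprime_of_span_singleton_eq
      ((show IsCoprime a (a - 1) from ⟨1, -1, by ring⟩).mul_right (hab₁.mul_right hab₂)) hspan
  obtain ⟨p, hpgt, hprime, hpa⟩ :=
    SerreSL2.Away.exists_prime_natCast_sub_mem hm0 hM hMc haM (max m 4)
  have hpm : ¬ p ∣ m := SerreSL2.Away.not_dvd_of_lt hm0 (lt_of_le_of_lt (le_max_left _ _) hpgt)
  have h5 : 5 ≤ p := by have := le_max_right m 4; omega
  haveI hmax : (Ideal.span {((p : ℕ) : Localization.Away (m : ℤ))}).IsMaximal :=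
    SerreSL2.Away.isMaximal_span_natCast_prime hm0 hprime hpm
  haveI : Finite (Localization.Away (m : ℤ) ⧸ Ideal.span {((p : ℕ) : Localization.Away (m : ℤ))}) :=
    SerreSL2.Away.finite_quotient_of_ne_bot hm0
      (by rw [Ne, Ideal.span_singleton_eq_bot]; exact natCast_ne_zero_away hm0 hprime.ne_zero)
  letI : Fintype (Localization.Away (m : ℤ) ⧸ Ideal.span {((p : ℕ) : Localization.Away (m : ℤ))}) :=
    Fintype.ofFinite _
  have hcard : Fintype.card (Localization.Away (m : ℤ) ⧸
      Ideal.span {((p : ℕ) : Localization.Away (m : ℤ))}) = p := by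
    rw [← Nat.card_eq_fintype_card]
    exact SerreSL2.Away.natCard_quotient_span_natCast hm0 ((Nat.Prime.coprime_iff_not_dvd hprime).2 hpm)
  -- `p = a + c(a-1)b₁b₂`
  rw [← hspan] at hpa
  obtain ⟨c, hc⟩ := Ideal.mem_span_singleton'.1 hpa
  have hπeq : ((p : ℕ) : Localization.Away (m : ℤ)) = a + c * (a - 1) * (b₁ * b₂) := by
    linear_combination -hc
  have hπ1 : ((p : ℕ) : Localization.Away (m : ℤ)) - 1 ∈ Ideal.span {z * z * (z * z)} := by
    rw [show ((p : ℕ) : Localization.Away (m : ℤ)) - 1 = (a - 1) + c * (b₁ * b₂) * (a - 1) by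
      rw [hπeq]; ring]
    exact (Ideal.span _).add_mem ha (Ideal.mul_mem_left _ _ ha)
  have hπb₁ : IsCoprime ((p : ℕ) : Localization.Away (m : ℤ)) b₁ := by
    rw [hπeq, show a + c * (a - 1) * (b₁ * b₂) = a + b₁ * (c * (a - 1) * b₂) by ring]
    exact hab₁.add_mul_left_left _
  have hπb₂ : IsCoprime ((p : ℕ) : Localization.Away (m : ℤ)) b₂ := by
    rw [hπeq, show a + c * (a - 1) * (b₁ * b₂) = a + b₂ * (c * (a - 1) * b₁) by ring]
    exact hab₂.add_mul_left_left _
  have key := sym_mul_sym_of_prime hm hz hz0 hπ1 hb₁ hb₂ hπb₁ hπb₂ hprime h5 hcard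
  -- back to `a` by (6)
  rw [hπeq, show a + c * (a - 1) * (b₁ * b₂) = a + (c * (a - 1) * b₂) * b₁ by ring,
    sym_add_mul_left ha𝔮 (hI𝔮 hb₁) hab₁,
    show a + c * (a - 1) * b₂ * b₁ = a + (c * (a - 1) * b₁) * b₂ by ring,
    sym_add_mul_left ha𝔮 (hI𝔮 hb₂) hab₂,
    show a + c * (a - 1) * b₁ * b₂ = a + (c * (a - 1)) * (b₁ * b₂) by ring,
    sym_add_mul_left ha𝔮 (𝔮.mul_mem_left _ (hI𝔮 hb₂)) (hab₁.mul_right hab₂)] at key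
  exact key


/-! ### Liehl's (12)–(14) over `ℤ[1/m]` -/

/-- Under (5), `ncl E(𝔮, A) = E(𝔮, A)`: two classes agree iff the quotient lies in `E(𝔮, A)`.
[cite: Liehl1981SL2Orders, §3 (5)] -/
theorem mk_eq_mk_iff {𝔮 : Ideal (Localization.Away (m : ℤ))} (h𝔮 : 𝔮 ≠ ⊥) (α β : relG 𝔮 ⊤) :
    (α : SymbGroup 𝔮) = β ↔ ((α : SL(2, Localization.Away (m : ℤ)))⁻¹ * β) ∈ relE 𝔮 ⊤ := by
  haveI := SL2Rel.isDomain_away (show m ≠ 0 by omega)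
  haveI := relE_subgroupOf_relG_normal hm h𝔮 (top_ne_bot : (⊤ : Ideal (Localization.Away (m : ℤ))) ≠ ⊥)
  have hncl : Subgroup.normalClosure (relEG 𝔮 : Set (relG 𝔮 ⊤)) = relEG 𝔮 :=
    le_antisymm (Subgroup.normalClosure_le_normal subset_rfl) Subgroup.subset_normalClosure
  rw [QuotientGroup.eq, hncl, Subgroup.mem_subgroupOf]
  rfl

/-- **Liehl (12)** for the pair `(𝔮, A)`: for `0 ≠ z ∈ 𝔮`, `a - 1 ∈ yz⁴A`, `b ∈ z²A`, `(a, b) = 1`: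
`[by over a] = [byz² over a] = [b over a][yz² over a] = [b over a]` by (8), (11), (6).
[cite: Liehl1981SL2Orders, §3 (12)] -/
theorem sym_mul_eq_of_mem_sq {𝔮 : Ideal (Localization.Away (m : ℤ))} {z : Localization.Away (m : ℤ)} (hz : z ∈ 𝔮) (hz0 : z ≠ 0) (y : Localization.Away (m : ℤ))
    {a b : Localization.Away (m : ℤ)} (ha : a - 1 ∈ Ideal.span {y * (z * z * (z * z))}) (hb : b ∈ Ideal.span {z * z})
    (hab : IsCoprime a b) : sym 𝔮 a (b * y) = sym 𝔮 a b := by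
  haveI := SL2Rel.isDomain_away (show m ≠ 0 by omega)
  have h𝔮 : 𝔮 ≠ ⊥ := fun h ↦ hz0 (by rw [h] at hz; exact hz)
  have hzz : z * z ∈ 𝔮 := 𝔮.mul_mem_left _ hz
  have hI𝔮 : Ideal.span {z * z} ≤ 𝔮 := (Ideal.span_singleton_le_iff_mem _).2 hzz
  obtain ⟨s, hs⟩ := Ideal.mem_span_singleton'.1 ha
  have ha𝔮 : a - 1 ∈ 𝔮 := by
    rw [← hs]; exact 𝔮.mul_mem_left _ (𝔮.mul_mem_left _ (𝔮.mul_mem_left _ hzz))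
  have hay : IsCoprime a y := ⟨1, -(s * (z * z * (z * z))), by linear_combination -hs⟩
  have hayzz : IsCoprime a (y * (z * z)) := by
    refine hay.mul_right ?_
    have haz : IsCoprime a z := ⟨1, -(s * y * z * (z * z)), by linear_combination -hs⟩
    exact haz.mul_right haz
  -- (8)
  have ha8 : a - 1 ∈ 𝔮 * Ideal.span {z * z} := by
    rw [← hs, show s * (y * (z * z * (z * z))) = (s * y * (z * z)) * (z * z) by ring]
    exact Ideal.mul_mem_mul (𝔮.mul_mem_left _ hzz) (Ideal.mem_span_singleton_self _)
  have s1 : sym 𝔮 a (z * z * (b * y)) = sym 𝔮 a (b * y) :=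
    sym_sq_mul_eq hm h𝔮 z ha8 (𝔮.mul_mem_right _ (hI𝔮 hb)) (hab.mul_right hay)
  -- (11)
  have ha4 : a - 1 ∈ Ideal.span {z * z * (z * z)} :=
    Ideal.mem_span_singleton'.2 ⟨s * y, by linear_combination hs⟩
  have s2 := sym_mul_sym hm hz hz0 ha4 hb
    (Ideal.mem_span_singleton'.2 ⟨y, rfl⟩ : y * (z * z) ∈ Ideal.span {z * z}) hab hayzz
  -- (6): `[yz² over a] = 1`
  have s3 : sym 𝔮 a (y * (z * z)) = 1 :=
    sym_eq_one_of_sub_one_mem_span (𝔮.mul_mem_left _ hzz)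
      (Ideal.mem_span_singleton'.2 ⟨s * (z * z), by linear_combination hs⟩)
  rw [← s1, show z * z * (b * y) = b * (y * (z * z)) by ring, ← s2, s3, mul_one]

omit hm in
omit [IsFractionRing (Localization.Away (m : ℤ)) F] in
/-- Conjugation by `diag(y, 1)` maps `E(𝔮, yA)` into `E(𝔮, A)`. [cite: Liehl1981SL2Orders, §3 (13) (proof)] -/
theorem exists_relE_map_eq_diagConj {𝔮 : Ideal (Localization.Away (m : ℤ))} {y : Localization.Away (m : ℤ)}
    (hy : algebraMap (Localization.Away (m : ℤ)) F y ≠ 0) {M : SL(2, Localization.Away (m : ℤ))} (hM : M ∈ relE 𝔮 (Ideal.span {y})) :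
    ∃ M' ∈ relE 𝔮 ⊤, SpecialLinearGroup.map (algebraMap (Localization.Away (m : ℤ)) F) M' =
      diagConj (Units.mk0 _ hy) (SpecialLinearGroup.map (algebraMap (Localization.Away (m : ℤ)) F) M) := by
  set f := algebraMap (Localization.Away (m : ℤ)) F with hf
  set r : Fˣ := Units.mk0 _ hy with hr
  refine Subgroup.closure_induction (p := fun M _ ↦ ∃ M' ∈ relE 𝔮 ⊤,
    SpecialLinearGroup.map f M' = diagConj r (SpecialLinearGroup.map f M)) ?_ ?_ ?_ ?_ hM
  · rintro _ (⟨x, hx, rfl⟩ | ⟨c, hc, rfl⟩)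
    · refine ⟨e12 (y * x), e12_mem_relE (𝔮.mul_mem_left _ hx), ?_⟩
      rw [map_e12, map_e12, diagConj_e12, hr, Units.val_mk0, map_mul]
    · rw [SetLike.mem_coe] at hc
      obtain ⟨c', rfl⟩ := Ideal.mem_span_singleton'.1 hc
      refine ⟨e21 c', e21_mem_relE Submodule.mem_top, ?_⟩
      rw [map_e21, map_e21, diagConj_e21, hr, Units.val_inv_eq_inv_val, Units.val_mk0, map_mul]
      congr 1
      field_simp
  · exact ⟨1, one_mem _, by simp⟩
  · rintro M N - - ⟨M', hM', hM'eq⟩ ⟨N', hN', hN'eq⟩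
    exact ⟨M' * N', mul_mem hM' hN', by rw [map_mul, hM'eq, hN'eq, map_mul, map_mul]⟩
  · rintro M - ⟨M', hM', hM'eq⟩
    exact ⟨M'⁻¹, inv_mem hM', by rw [map_inv, hM'eq, map_inv, map_inv]⟩

/-- **Liehl (13)** for the pair `(𝔮, A)`: for `a - 1 ∈ 𝔮y`, `b ∈ 𝔮`, `(a, b) = 1`:
`[by over a] = [b over a]`.  Proof as printed: complete `(a, b)` to `α ∈ G(𝔮, yA)`, write `α = βε`
with `β ∈ G(I', I')`, `I' = yz²A` (`z ∈ 𝔮`), `ε ∈ E(𝔮, yA)`, by (1); for `g = diag(y, 1)`, (12)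
gives `gβg⁻¹ ∈ βE(𝔮, A)`, so `α⁻¹gαg⁻¹ ∈ E(𝔮, A)`, and `gαg⁻¹` has first row `(a, by)`.
[cite: Liehl1981SL2Orders, §3 (13)] -/
theorem sym_mul_eq {𝔮 : Ideal (Localization.Away (m : ℤ))} (h𝔮 : 𝔮 ≠ ⊥) (y : Localization.Away (m : ℤ)) {a b : Localization.Away (m : ℤ)}
    (ha : a - 1 ∈ 𝔮 * Ideal.span {y}) (hb : b ∈ 𝔮) (hab : IsCoprime a b) :
    sym 𝔮 a (b * y) = sym 𝔮 a b := by
  have hm0 : m ≠ 0 := by omega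
  haveI := SL2Rel.isDomain_away hm0
  haveI := SL2Rel.isDedekindDomain_away hm0
  by_cases hy0 : y = 0
  · have ha1 : a = 1 := by
      rw [hy0, Ideal.span_singleton_zero, Ideal.mul_bot, Ideal.mem_bot, sub_eq_zero] at ha
      exact ha
    rw [ha1, hy0, mul_zero, sym_one_zero, sym_one_left hb]
  set f := algebraMap (Localization.Away (m : ℤ)) (FractionRing (Localization.Away (m : ℤ))) with hf
  have hinj := map_injective f (IsFractionRing.injective (Localization.Away (m : ℤ)) (FractionRing (Localization.Away (m : ℤ))))
  have hy : f y ≠ 0 := fun h ↦ hy0 (IsFractionRing.injective (Localization.Away (m : ℤ)) (FractionRing (Localization.Away (m : ℤ))) (by rw [h, map_zero]))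
  set r : (FractionRing (Localization.Away (m : ℤ)))ˣ := Units.mk0 _ hy with hr
  have ha𝔮 : a - 1 ∈ 𝔮 := Ideal.mul_le_right ha
  obtain ⟨z, hz, hz0⟩ := Submodule.exists_mem_ne_zero_of_ne_bot h𝔮
  have hzz : z * z ∈ 𝔮 := 𝔮.mul_mem_left _ hz
  -- `α ∈ G(𝔮, yA)`, `β = αε ∈ G(I', I')`, `I' = yz²A`
  obtain ⟨α, hα, h0, h1⟩ := exists_relG_of_row ha hb hab
  set I' : Ideal (Localization.Away (m : ℤ)) := Ideal.span {y * (z * z)} with hI'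
  have hI'0 : I' ≠ ⊥ := by
    rw [hI', Ne, Ideal.span_singleton_eq_bot]; exact mul_ne_zero hy0 (mul_ne_zero hz0 hz0)
  have hI'𝔮 : I' ≤ 𝔮 := (Ideal.span_singleton_le_iff_mem _).2 (𝔮.mul_mem_left _ hzz)
  obtain ⟨ε, hε, hβ⟩ := exists_mul_relE_mem_relG hI'0 hI'𝔮 hα
  -- (12) for `β`: the classes of `β' = gβg⁻¹` and `β` agree
  set β : SL(2, Localization.Away (m : ℤ)) := α * ε with hβdef
  obtain ⟨c₁, hc₁⟩ := Ideal.mem_span_singleton'.1 hβ.2.1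
  -- `hc₁ : c₁ * (y * (z * z)) = β 1 0`
  have hβdet : β 0 0 * β 1 1 - y * β 0 1 * (c₁ * (z * z)) = 1 := by
    have := det_two β; rw [← hc₁] at this; linear_combination this
  obtain ⟨β', e00, e01, e10, e11⟩ : ∃ β' : SL(2, Localization.Away (m : ℤ)), β' 0 0 = β 0 0 ∧ β' 0 1 = y * β 0 1 ∧
      β' 1 0 = c₁ * (z * z) ∧ β' 1 1 = β 1 1 :=
    ⟨⟨!![β 0 0, y * β 0 1; c₁ * (z * z), β 1 1], by rw [Matrix.det_fin_two_of]; exact hβdet⟩,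
      rfl, rfl, rfl, rfl⟩
  have hβ01 : β 0 1 ∈ 𝔮 := hI'𝔮 hβ.1
  have hβ00 : β 0 0 - 1 ∈ 𝔮 := (Ideal.mul_le_right.trans hI'𝔮) hβ.2.2.1
  have hβG : β ∈ relG 𝔮 ⊤ := relG_mono hI'𝔮 le_top hβ
  have hβ'G : β' ∈ relG 𝔮 ⊤ := by
    refine ⟨?_, Submodule.mem_top, ?_, ?_⟩
    · rw [e01]; exact 𝔮.mul_mem_left _ hβ01
    · rw [e00, Ideal.mul_top]; exact hβ00
    · rw [e11, Ideal.mul_top]; exact (Ideal.mul_le_right.trans hI'𝔮) hβ.2.2.2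
  have h12 : ((⟨β', hβ'G⟩ : relG 𝔮 ⊤) : SymbGroup 𝔮) = (⟨β, hβG⟩ : relG 𝔮 ⊤) := by
    rw [← sym_eq_mk ⟨β', hβ'G⟩ (a := β 0 0) (b := β 0 1 * y) e00 (by rw [e01, mul_comm]),
      ← sym_eq_mk ⟨β, hβG⟩ rfl rfl]
    refine sym_mul_eq_of_mem_sq hm hz hz0 y ?_ ?_ (isCoprime_row β)
    · have : I' * I' ≤ Ideal.span {y * (z * z * (z * z))} := by
        rw [hI', Ideal.span_singleton_mul_span_singleton, Ideal.span_singleton_le_span_singleton]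
        exact ⟨y, by ring⟩
      exact this hβ.2.2.1
    · exact (Ideal.span_singleton_le_span_singleton.2 ⟨y, by ring⟩ : I' ≤ Ideal.span {z * z}) hβ.1
  rw [mk_eq_mk_iff hm h𝔮] at h12
  -- `h12 : β'⁻¹ * β ∈ E(𝔮, A)`; and `ι β' = g (ι β) g⁻¹`
  have hgβ : SpecialLinearGroup.map f β' = diagConj r (SpecialLinearGroup.map f β) := by
    obtain ⟨k00, k01, k10, k11⟩ := diagConj_apply r (SpecialLinearGroup.map f β)
    ext i j
    fin_cases i <;> fin_cases j <;> simp only [Fin.zero_eta, Fin.isValue, Fin.mk_one]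
    · rw [k00, map_apply_two, map_apply_two, e00]
    · rw [k01, map_apply_two, map_apply_two, hr, Units.val_mk0, e01, map_mul]
    · rw [k10, map_apply_two, map_apply_two, ← hc₁, e10]
      symm
      rw [Units.inv_mul_eq_iff_eq_mul, hr, Units.val_mk0, ← map_mul]
      congr 1; ring
    · rw [k11, map_apply_two, map_apply_two, e11]
  -- the integral matrix `α'` with `ι α' = g (ι α) g⁻¹`
  obtain ⟨c₂, hc₂⟩ := Ideal.mem_span_singleton'.1 hα.2.1
  have hαdet : a * α 1 1 - y * b * c₂ = 1 := by
    have := det_two α; rw [h0, h1, ← hc₂] at this; linear_combination this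
  obtain ⟨α', a00, a01, a10, a11⟩ : ∃ α' : SL(2, Localization.Away (m : ℤ)), α' 0 0 = a ∧ α' 0 1 = y * b ∧
      α' 1 0 = c₂ ∧ α' 1 1 = α 1 1 :=
    ⟨⟨!![a, y * b; c₂, α 1 1], by rw [Matrix.det_fin_two_of]; exact hαdet⟩, rfl, rfl, rfl, rfl⟩
  have hαG : α ∈ relG 𝔮 ⊤ := relG_mono le_rfl le_top hα
  have hα'G : α' ∈ relG 𝔮 ⊤ := by
    refine ⟨?_, Submodule.mem_top, ?_, ?_⟩
    · rw [a01]; exact 𝔮.mul_mem_left _ hb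
    · rw [a00, Ideal.mul_top]; exact ha𝔮
    · rw [a11, Ideal.mul_top]; exact Ideal.mul_le_right hα.2.2.2
  have hgα : SpecialLinearGroup.map f α' = diagConj r (SpecialLinearGroup.map f α) := by
    obtain ⟨k00, k01, k10, k11⟩ := diagConj_apply r (SpecialLinearGroup.map f α)
    ext i j
    fin_cases i <;> fin_cases j <;> simp only [Fin.zero_eta, Fin.isValue, Fin.mk_one]
    · rw [k00, map_apply_two, map_apply_two, h0, a00]
    · rw [k01, map_apply_two, map_apply_two, h1, hr, Units.val_mk0, a01, map_mul]
    · rw [k10, map_apply_two, map_apply_two, ← hc₂, a10]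
      symm
      rw [Units.inv_mul_eq_iff_eq_mul, hr, Units.val_mk0, ← map_mul, mul_comm]
    · rw [k11, map_apply_two, map_apply_two, a11]
  -- `α⁻¹ α' ∈ E(𝔮, A)`
  obtain ⟨M₁, hM₁, hM₁eq⟩ := exists_relE_map_eq_diagConj hy (inv_mem hε)
  change SpecialLinearGroup.map f M₁ = diagConj r (SpecialLinearGroup.map f ε⁻¹) at hM₁eq
  have key : SpecialLinearGroup.map f (α⁻¹ * α') =
      SpecialLinearGroup.map f (ε * (β'⁻¹ * β)⁻¹ * M₁) := by
    simp only [map_mul, map_inv, hgα, hgβ, hM₁eq, hβdef]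
    group
  have hmem : α⁻¹ * α' ∈ relE 𝔮 ⊤ := by
    rw [hinj key]
    exact mul_mem (mul_mem (relE_mono le_rfl le_top hε) (inv_mem h12)) hM₁
  rw [sym_eq_mk ⟨α', hα'G⟩ (a := a) (b := b * y) a00 (by rw [a01, mul_comm]),
    sym_eq_mk ⟨α, hαG⟩ h0 h1]
  exact ((mk_eq_mk_iff hm h𝔮 ⟨α, hαG⟩ ⟨α', hα'G⟩).2 hmem).symm

/-- **Liehl (14)** for the pair `(𝔮, A)`: `[b over a₁a₂] = [b over a₁][b over a₂]` for
`(a₁, b), (a₂, b) ∈ W(𝔮, A)`: with `α = (a₂ b; c d)`, `(a₁a₂, b)α⁻¹ = (1 + a₂d(a₁ - 1), a₂b(1 - a₁))`,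
and `[a₂b(1 - a₁) over 1 + a₂d(a₁ - 1)] = [b(1 - a₁) over a₁ + bc(a₁ - 1)] = [b over a₁]` by (13), (6).
[cite: Liehl1981SL2Orders, §3 (14)] -/
theorem sym_mul_left {𝔮 : Ideal (Localization.Away (m : ℤ))} (h𝔮 : 𝔮 ≠ ⊥) {a₁ a₂ b : Localization.Away (m : ℤ)} (ha₁ : a₁ - 1 ∈ 𝔮)
    (ha₂ : a₂ - 1 ∈ 𝔮) (hb : b ∈ 𝔮) (h₁ : IsCoprime a₁ b) (h₂ : IsCoprime a₂ b) :
    sym 𝔮 (a₁ * a₂) b = sym 𝔮 a₁ b * sym 𝔮 a₂ b := by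
  obtain ⟨α, h0, h1, hs₂⟩ := exists_sym_eq_mk ha₂ hb h₂
  have ha₁₂ : a₁ * a₂ - 1 ∈ 𝔮 := by
    rw [show a₁ * a₂ - 1 = (a₁ - 1) * a₂ + (a₂ - 1) by ring]
    exact 𝔮.add_mem (𝔮.mul_mem_right _ ha₁) ha₂
  obtain ⟨γ, k0, k1, hs₁₂⟩ := exists_sym_eq_mk ha₁₂ hb (h₁.mul_left h₂)
  obtain ⟨α₁, l0, l1, hs₁⟩ := exists_sym_eq_mk ha₁ hb h₁
  rw [hs₁₂, hs₁, hs₂, ← mul_inv_eq_iff_eq_mul, ← QuotientGroup.mk_inv, ← QuotientGroup.mk_mul]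
  -- the row of `γ α⁻¹`
  set c := (α : SL(2, Localization.Away (m : ℤ))) 1 0 with hc
  set d := (α : SL(2, Localization.Away (m : ℤ))) 1 1 with hd
  have hdet : a₂ * d - b * c = 1 := by have := det_two (α : SL(2, Localization.Away (m : ℤ))); rwa [h0, h1] at this
  obtain ⟨i00, i01, i10, i11⟩ := inv_apply_two (α : SL(2, Localization.Away (m : ℤ)))
  have r0 : ((γ * α⁻¹ : relG 𝔮 ⊤) : SL(2, Localization.Away (m : ℤ))) 0 0 = 1 + a₂ * d * (a₁ - 1) := by
    rw [Subgroup.coe_mul, Subgroup.coe_inv, mul_apply_two, i00, i10, k0, k1, ← hc, ← hd]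
    linear_combination hdet
  have r1 : ((γ * α⁻¹ : relG 𝔮 ⊤) : SL(2, Localization.Away (m : ℤ))) 0 1 = a₂ * b * (1 - a₁) := by
    rw [Subgroup.coe_mul, Subgroup.coe_inv, mul_apply_two, i01, i11, k0, k1, h1, h0]; ring
  rw [← sym_eq_mk (γ * α⁻¹) r0 r1]
  -- (13) with `y = a₂`
  have hA : 1 + a₂ * d * (a₁ - 1) - 1 ∈ 𝔮 * Ideal.span {a₂} := by
    rw [show 1 + a₂ * d * (a₁ - 1) - 1 = d * (a₁ - 1) * a₂ by ring]
    exact Ideal.mul_mem_mul (𝔮.mul_mem_left _ ha₁) (Ideal.mem_span_singleton_self _)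
  have hB : b * (1 - a₁) ∈ 𝔮 := 𝔮.mul_mem_right _ hb
  have hAB : IsCoprime (1 + a₂ * d * (a₁ - 1)) (b * (1 - a₁)) := by
    have := isCoprime_row ((γ * α⁻¹ : relG 𝔮 ⊤) : SL(2, Localization.Away (m : ℤ)))
    rw [r0, r1, show a₂ * b * (1 - a₁) = a₂ * (b * (1 - a₁)) by ring] at this
    exact this.of_mul_right_right
  have s1 := sym_mul_eq hm h𝔮 a₂ hA hB hAB
  rw [show b * (1 - a₁) * a₂ = a₂ * b * (1 - a₁) by ring] at s1
  rw [s1, show 1 + a₂ * d * (a₁ - 1) = a₁ + (-c) * (b * (1 - a₁)) by linear_combination (a₁ - 1) * hdet]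
  -- (6)
  have h₁' : IsCoprime a₁ (b * (1 - a₁)) := h₁.mul_right ⟨1, 1, by ring⟩
  rw [sym_add_mul_left ha₁ hB h₁' (-c), show b * (1 - a₁) = b + (-b) * a₁ by ring,
    sym_add_mul_right ha₁ hb h₁ (𝔮.neg_mem hb)]
  exact hs₁


/-! ### Liehl's (7) = MS2 over `ℤ[1/m]` -/

omit hm in
/-- `[b over a] = [b(1 - a) over a]` by (6) (`x = -b`). [cite: Liehl1981SL2Orders, §3 (7) (proof)] -/
theorem sym_eq_sym_mul_one_sub {𝔮 : Ideal (Localization.Away (m : ℤ))} {a b : Localization.Away (m : ℤ)} (ha : a - 1 ∈ 𝔮) (hb : b ∈ 𝔮)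
    (hab : IsCoprime a b) : sym 𝔮 a b = sym 𝔮 a (b * (1 - a)) := by
  rw [show b * (1 - a) = b + (-b) * a by ring, sym_add_mul_right ha hb hab (𝔮.neg_mem hb)]

omit hm in
/-- `(a, b(1 - a)) = 1` from `(a, b) = 1`. [folklore] -/
private theorem isCoprime_mul_one_sub {a b : Localization.Away (m : ℤ)} (hab : IsCoprime a b) :
    IsCoprime a (b * (1 - a)) :=
  hab.mul_right ⟨1, 1, by ring⟩

/-- **The key identity in the proof of (7)**: with `t = 1 - a`, for `(a, b) ∈ W(𝔮, A)`:
`[bt² over a] = [-ta over a + bt]`, via `[bt² over 1 + bt] = 1`, (14) and (6).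
[cite: Liehl1981SL2Orders, §3 (7) (proof)] -/
theorem sym_mul_sq_eq {𝔮 : Ideal (Localization.Away (m : ℤ))} (h𝔮 : 𝔮 ≠ ⊥) {a b : Localization.Away (m : ℤ)} (ha : a - 1 ∈ 𝔮)
    (hab : IsCoprime a b) :
    sym 𝔮 a (b * (1 - a) * (1 - a)) = sym 𝔮 (a + b * (1 - a)) (-((1 - a) * a)) := by
  set t := 1 - a with ht
  have ht𝔮 : t ∈ 𝔮 := by rw [ht, ← neg_sub]; exact 𝔮.neg_mem ha
  have hbt : b * t ∈ 𝔮 := 𝔮.mul_mem_left _ ht𝔮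
  have hbt2 : b * t * t ∈ 𝔮 := 𝔮.mul_mem_left _ ht𝔮
  have hat : IsCoprime a t := ⟨1, 1, by rw [ht]; ring⟩
  have habt2 : IsCoprime a (b * t * t) := (hab.mul_right hat).mul_right hat
  -- `[bt² over 1 + bt] = [-t over 1 + bt] = 1`
  have h1bt : 1 + b * t - 1 ∈ 𝔮 := by rw [add_sub_cancel_left]; exact hbt
  have hc1 : IsCoprime (1 + b * t) (b * t * t) :=
    IsCoprime.mul_right ⟨1, -1, by ring⟩ ⟨1, -b, by ring⟩
  have K1 : sym 𝔮 (1 + b * t) (b * t * t) = 1 := by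
    have h := sym_add_mul_right h1bt hbt2 hc1 (𝔮.neg_mem ht𝔮)
    rw [show b * t * t + -t * (1 + b * t) = -t by ring] at h
    rw [← h]
    exact sym_eq_one_of_sub_one_mem_span (𝔮.neg_mem ht𝔮)
      (Ideal.mem_span_singleton'.2 ⟨-b, by ring⟩)
  -- (14): `[bt² over a(1 + bt)] = [bt² over a][bt² over 1 + bt]`
  have K2 := sym_mul_left hm h𝔮 ha h1bt hbt2 habt2 hc1
  rw [K1, mul_one] at K2
  -- (6): `a(1 + bt) = (a + bt) - bt²`, then `bt² - t(a + bt) = -ta`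
  have ha' : a + b * t - 1 ∈ 𝔮 := by
    rw [show a + b * t - 1 = (a - 1) + b * t by ring]; exact 𝔮.add_mem ha hbt
  have hc2 : IsCoprime (a + b * t) (b * t * t) := by
    refine IsCoprime.mul_right (IsCoprime.mul_right ?_ ?_) ?_
    · exact hab.add_mul_left_left t
    · exact ⟨1, 1 - b, by rw [ht]; ring⟩
    · exact ⟨1, 1 - b, by rw [ht]; ring⟩
  have K3 : sym 𝔮 (a * (1 + b * t)) (b * t * t) = sym 𝔮 (a + b * t) (b * t * t) := by
    rw [show a * (1 + b * t) = (a + b * t) + (-1) * (b * t * t) by rw [ht]; ring]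
    exact sym_add_mul_left ha' hbt2 hc2 (-1)
  have K4 := sym_add_mul_right ha' hbt2 hc2 (𝔮.neg_mem ht𝔮)
  rw [show b * t * t + -t * (a + b * t) = -(t * a) by ring] at K4
  rw [← K2, K3, K4]

omit hm in
/-- `(a + c, ta) = 1` when `(a, c) = (t, a + c) = 1`. [folklore] -/
private theorem isCoprime_add_neg_mul {a c t : Localization.Away (m : ℤ)} (hac : IsCoprime a c)
    (ht : IsCoprime (a + c) t) : IsCoprime (a + c) (-(t * a)) := by
  have h : IsCoprime (a + c) a := by simpa [add_comm] using hac.symm.add_mul_left_left 1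
  exact (ht.mul_right h).neg_right

/-- **Liehl (7) = MS2** for the pair `(𝔮, A)`: `[b₁b₂ over a] = [b₁ over a][b₂ over a]` for
`(a, b₁), (a, b₂) ∈ W(𝔮, A)`. [cite: Liehl1981SL2Orders, §3 (7)] -/
theorem sym_mul_right {𝔮 : Ideal (Localization.Away (m : ℤ))} (h𝔮 : 𝔮 ≠ ⊥) {a b₁ b₂ : Localization.Away (m : ℤ)} (ha : a - 1 ∈ 𝔮)
    (hb₁ : b₁ ∈ 𝔮) (hb₂ : b₂ ∈ 𝔮) (h₁ : IsCoprime a b₁) (h₂ : IsCoprime a b₂) :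
    sym 𝔮 a (b₁ * b₂) = sym 𝔮 a b₁ * sym 𝔮 a b₂ := by
  have ht𝔮 : 1 - a ∈ 𝔮 := by rw [← neg_sub]; exact 𝔮.neg_mem ha
  have hat : IsCoprime a (1 - a) := ⟨1, 1, by ring⟩
  have h₁₂ : IsCoprime a (b₁ * b₂) := h₁.mul_right h₂
  -- `[b] = [bt] = [bt²] (= [bt³])`, `t = 1 - a`
  have L : ∀ {b : Localization.Away (m : ℤ)}, b ∈ 𝔮 → IsCoprime a b → sym 𝔮 a b = sym 𝔮 a (b * (1 - a) * (1 - a)) := by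
    intro b hb hab
    rw [sym_eq_sym_mul_one_sub ha hb hab, sym_eq_sym_mul_one_sub ha (𝔮.mul_mem_left _ ht𝔮)
      (isCoprime_mul_one_sub hab)]
  rw [sym_eq_sym_mul_one_sub ha (𝔮.mul_mem_left _ hb₂) h₁₂, L hb₁ h₁, L hb₂ h₂,
    L (𝔮.mul_mem_left _ ht𝔮) (isCoprime_mul_one_sub h₁₂)]
  -- the key identity for `b₁`, `b₂`, `b₁b₂t`
  rw [sym_mul_sq_eq hm h𝔮 ha h₁, sym_mul_sq_eq hm h𝔮 ha h₂,
    sym_mul_sq_eq hm h𝔮 ha (isCoprime_mul_one_sub h₁₂)]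
  -- (14) and (6)
  have hta : -((1 - a) * a) ∈ 𝔮 := 𝔮.neg_mem (𝔮.mul_mem_right _ ht𝔮)
  have hA : ∀ {c : Localization.Away (m : ℤ)}, c ∈ 𝔮 → a + c - 1 ∈ 𝔮 := fun {c} hc ↦ by
    rw [show a + c - 1 = (a - 1) + c by ring]; exact 𝔮.add_mem ha hc
  have hm₁ : b₁ * (1 - a) ∈ 𝔮 := 𝔮.mul_mem_left b₁ ht𝔮
  have hm₂ : b₂ * (1 - a) ∈ 𝔮 := 𝔮.mul_mem_left b₂ ht𝔮
  have hm₁₂ : b₁ * b₂ * (1 - a) * (1 - a) ∈ 𝔮 := 𝔮.mul_mem_left (b₁ * b₂ * (1 - a)) ht𝔮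
  have hT : ∀ c : Localization.Away (m : ℤ), IsCoprime (a + c * (1 - a)) (1 - a) := fun c ↦ ⟨1, 1 - c, by ring⟩
  have hc₁ : IsCoprime (a + b₁ * (1 - a)) (-((1 - a) * a)) :=
    isCoprime_add_neg_mul (h₁.mul_right hat) (hT b₁)
  have hc₂ : IsCoprime (a + b₂ * (1 - a)) (-((1 - a) * a)) :=
    isCoprime_add_neg_mul (h₂.mul_right hat) (hT b₂)
  have hc₁₂ : IsCoprime (a + b₁ * b₂ * (1 - a) * (1 - a)) (-((1 - a) * a)) := by
    have := isCoprime_add_neg_mul ((h₁₂.mul_right hat).mul_right hat) (hT (b₁ * b₂ * (1 - a)))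
    simpa [mul_assoc] using this
  have h14 := sym_mul_left hm h𝔮 (hA hm₁) (hA hm₂) hta hc₁ hc₂
  have h6 := sym_add_mul_left (hA hm₁₂) hta hc₁₂ (1 - b₁ - b₂)
  rw [← h14, show (a + b₁ * (1 - a)) * (a + b₂ * (1 - a)) =
      (a + b₁ * b₂ * (1 - a) * (1 - a)) + (1 - b₁ - b₂) * (-((1 - a) * a)) by ring, h6]

end Liehl

end Away

end SL2Rel

end Literature.NumberTheory.Automorphic
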